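import Summits.KontsevichZagierPeriods.KontsevichZagierPeriods.Theses.FurushoPentagon
import Summits.KontsevichZagierPeriods.KontsevichZagierPeriods.Theorems.FurushoPentagonReducedPeriodRingDefs
import Summits.KontsevichZagierPeriods.KontsevichZagierPeriods.Theorems.FurushoPentagonReducedPeriodRingCubeMerge
import Literature.NumberTheory.Transcendental.KZCubicalCalculus
import Literature.NumberTheory.Transcendental.KZProductIdeal
import Literature.NumberTheory.Transcendental.KZRulesAssociator
import Literature.NumberTheory.Transcendental.AyoubPeriodSeries
import Literature.NumberTheory.Transcendental.AyoubPeriodSeriesKernel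
import Literature.NumberTheory.Transcendental.KZLogCalculusProofs

/-!
# drefute certificates — crux `SectorToKernel` (stmt-KontsevichZagierPeriods-10813), line `effective-cube-surjection`

Refuter `refuter-drefute-stmt-KontsevichZagierPeriods-10813-0`, running parallel to the lead
`prover-line-stmt-KontsevichZagierPeriods-10813-0`. STUB SET ATTACKED = the lead's registry of
2026-08-16T04:27:59Z (`Cruxes/SectorToKernel/Lines/effective-cube-surjection.lean`, six stubs S1–S6, copied
VERBATIM in §0 below; the planner's gen-2 seven-stub registry `cf2fa037…` was superseded by it and is only
treated in the appendix §A).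

**Verdict: 0 stub-false, 0 stub-misstated; S1–S6 survive the cheap arsenal** (elaboration, degenerate
dimensions, vacuity, hypothesis mutation, junk hunt in `Oan / intC / relAC / kSpan`, literature check of the
leaf against André's account of Ayoub's reformulation). Everything below is `sorry`-free except the §0
probes (one `sorry` each, by design: they only certify that the verbatim signatures elaborate).

* §0 the six registered signatures, verbatim, elaborate (`S1 … S6`, `Adm`).
* §1 `S5_dim0` — S5 `stub_stokesSpanCalibration` at `M = 0` holds (the index type `Fin k → Fin 0` forces the
  Stokes sum to be empty, the integrand vanishes at the point, rule 1b).
* §2 `S3_dim0` — the CONCLUSION of S3 `stub_realStokesForm` at `m = 0` holds outright (`d = k = 0`): the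
  admissibility bracket pins `s(pt) = coeff 0 F`, and `∫_{pt} s = s(pt)`; so no degenerate counterexample.
* §3 `S6_supset` — the `⊇` half of the leaf is the tree theorem `AyoubRel.intC_relAC_eq_zero` (restated for
  the exact Stokes set of S6): the leaf is consistent with soundness; it is Ayoub, Ann. of Math. 181 (2015)
  Conj. 1.1 over `k = ℚ` (André, Colloquium De Giorgi 2010–12, §2.4: kernel of `∫_□` on functions holomorphic
  on `|zᵢ| ≤ 1` and algebraic over `ℚ(z)` "generated by" `∂g/∂zᵢ − g|₁ + g|₀`), summit-strength, not attacked.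
* §A (superseded gen-2 registry) `gen2_stub_evalEqIntC_false_of_readingR` — the planner's T3 `stub_evalEqIntC`
  carried no `IsReal F`; under the real-part reading of its private `Realises` it is FALSE (witness `F = i`,
  `M = 0`). Moot for the lead's skeleton (no `Realises`; S2/S3 use a REAL `MvPowerSeries (Fin m) ℝ`), recorded so
  that nobody resurrects that signature without the hypothesis.
-/

noncomputable section

set_option linter.dupNamespace false

namespace Summit.KontsevichZagierPeriods.KontsevichZagierPeriods.Cruxes.SectorToKernel.DrefuteECS

open Set MeasureTheory
open Literature.NumberTheory.Transcendental
open Literature.NumberTheory.Transcendental.KZ hiding cubicalSpan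
open Literature.NumberTheory.Transcendental.AyoubRel (CSeries Oan intC relAC kSpan DependsOnlyOnLT pdz restrC)
open Summit.KontsevichZagierPeriods.KontsevichZagierPeriods.Theses.FurushoPentagon
open Summit.KontsevichZagierPeriods.FurushoPentagon.ReducedPeriodRing (unitCube cubicalGens cubicalSpan)

/-! ## §0 The lead's six stubs, verbatim (elaboration probes) -/

/-- The Stokes set of the leaf. -/
def StokesSet : Set CSeries := {x : CSeries | ∃ G ∈ Oan (Rat.castHom ℂ), ∃ i : ℕ, x = relAC i G}

/-- S6 `stub_ayoubEffectiveCubeKernel` (the leaf), verbatim. -/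
def S6 : Prop := ∀ F ∈ AyoubRel.Oan (Rat.castHom ℂ), AyoubRel.intC F = 0 → F ∈ AyoubRel.kSpan (Rat.castHom ℂ) {x : AyoubRel.CSeries | ∃ G ∈ AyoubRel.Oan (Rat.castHom ℂ), ∃ i : ℕ, x = AyoubRel.relAC i G}

/-- The admissibility bracket shared by S2 and S3, verbatim. -/
def Adm (m : ℕ) (s : IntegralRep m) : Prop := ∃ (F : MvPowerSeries (Fin m) ℝ) (ρ : ℝ), 1 < ρ ∧ Summable (fun a : Fin m →₀ ℕ => |MvPowerSeries.coeff a F| * ρ ^ (a.sum fun _ e => e)) ∧ (∀ x ∈ KZ.cube m, HasSum (fun a : Fin m →₀ ℕ => MvPowerSeries.coeff a F * a.prod (fun j e => x j ^ e)) (s.integrand x)) ∧ ∃ P : Polynomial (MvPolynomial (Fin m) ℚ), P ≠ 0 ∧ ∀ x ∈ KZ.cube m, Polynomial.eval₂ (MvPolynomial.aeval x : MvPolynomial (Fin m) ℚ →ₐ[ℚ] ℝ).toRingHom (s.integrand x) P = 0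

/-- The conclusion of S3 for a given `s`, verbatim. -/
def RealStokesForm (m : ℕ) (s : IntegralRep m) : Prop := ∃ (d k : ℕ) (i : Fin k → Fin (m + d)) (H : Fin k → (Fin (m + d) → ℝ) → ℝ), (∀ j, AnalyticOnNhd ℝ (H j) (KZ.cube (m + d)) ∧ ∃ P : Polynomial (MvPolynomial (Fin (m + d)) ℚ), P ≠ 0 ∧ ∀ x ∈ KZ.cube (m + d), Polynomial.eval₂ (MvPolynomial.aeval x : MvPolynomial (Fin (m + d)) ℚ →ₐ[ℚ] ℝ).toRingHom (H j x) P = 0) ∧ ∀ z ∈ KZ.cube (m + d), s.integrand (fun a => z (Fin.castAdd d a)) = ∑ j, (fderiv ℝ (H j) z (Pi.single (i j) 1) - H j (Function.update z (i j) 1) + H j (Function.update z (i j) 0))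

/-- S1 `stub_cubeResolution`, verbatim. -/
def S1 : Prop := ∀ (N : ℕ) (u : IntegralRep N), ∃ c : FormalRep, c ∈ cubicalSpan ∧ of u - c ∈ relations
/-- S2 `stub_admissibleOfTame`, verbatim. -/
def S2 : Prop := ∀ (n : ℕ) (r : IntegralRep n), r.domain = KZ.cube n → AnalyticOnNhd ℝ r.integrand (KZ.cube n) → ∃ s : IntegralRep n, s.domain = KZ.cube n ∧ Adm n s ∧ of r - of s ∈ relations
/-- S3 `stub_realStokesForm`, verbatim. -/
def S3 : Prop := S6 → ∀ (m : ℕ) (s : IntegralRep m), s.domain = KZ.cube m → Adm m s → ∫ x in KZ.cube m, s.integrand x = 0 → RealStokesForm m s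
/-- S4 `stub_semialgebraicOfAlgebraic`, verbatim. -/
def S4 : Prop := ∀ (M : ℕ) (H : (Fin M → ℝ) → ℝ), AnalyticOnNhd ℝ H (KZ.cube M) → (∃ P : Polynomial (MvPolynomial (Fin M) ℚ), P ≠ 0 ∧ ∀ x ∈ KZ.cube M, Polynomial.eval₂ (MvPolynomial.aeval x : MvPolynomial (Fin M) ℚ →ₐ[ℚ] ℝ).toRingHom (H x) P = 0) → IsSemialgebraicFunOn ℚ (KZ.cube M) H
/-- S5 `stub_stokesSpanCalibration`, verbatim. -/
def S5 : Prop := ∀ (M : ℕ) (t : IntegralRep M), t.domain = KZ.cube M → ∀ (k : ℕ) (i : Fin k → Fin M) (H : Fin k → (Fin M → ℝ) → ℝ), (∀ j, AnalyticOnNhd ℝ (H j) (KZ.cube M) ∧ IsSemialgebraicFunOn ℚ (KZ.cube M) (H j)) → (∀ z ∈ KZ.cube M, t.integrand z = ∑ j, (fderiv ℝ (H j) z (Pi.single (i j) 1) - H j (Function.update z (i j) 1) + H j (Function.update z (i j) 0))) → of t ∈ relations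

/-- The six verbatim signatures elaborate (this definition type-checks iff they do). [folklore] -/
theorem stubSet_elaborates : (S1 ∧ S2 ∧ S3 ∧ S4 ∧ S5 ∧ S6) → S1 := fun h => h.1

/-! ## §1 S5 in dimension 0 -/

/-- **S5 at `M = 0` holds.** [folklore] -/
theorem S5_dim0 (t : IntegralRep 0) (ht : t.domain = KZ.cube 0) (k : ℕ) (i : Fin k → Fin 0)
    (H : Fin k → (Fin 0 → ℝ) → ℝ)
    (hsum : ∀ z ∈ KZ.cube 0, t.integrand z = ∑ j, (fderiv ℝ (H j) z (Pi.single (i j) 1)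
      - H j (Function.update z (i j) 1) + H j (Function.update z (i j) 0))) :
    of t ∈ relations := by
  apply KZ.of_mem_relations_of_eqOn_zero
  intro x hx
  rw [ht] at hx
  rw [hsum x hx, Pi.zero_apply]
  exact Finset.sum_eq_zero fun j _ => (i j).elim0

/-! ## §2 The conclusion of S3 in dimension 0 -/

/-- Over `Fin 0 → ℝ` the integral over the cube is evaluation at the point. [folklore] -/
theorem setIntegral_cube_zero (f : (Fin 0 → ℝ) → ℝ) (x0 : Fin 0 → ℝ) :
    ∫ x in KZ.cube 0, f x = f x0 := by
  have hcube : KZ.cube 0 = Set.univ := by ext x; simp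
  rw [hcube, Measure.restrict_univ, Measure.volume_pi_eq_dirac x0, integral_dirac]

/-- **The conclusion of S3 at `m = 0` holds outright** (take `d = k = 0`): admissibility pins
`s(pt) = coeff 0 F` and `∫_{pt} s = s(pt) = 0`. [folklore] -/
theorem S3_dim0 (s : IntegralRep 0) (_hs : s.domain = KZ.cube 0) (_hadm : Adm 0 s)
    (hint : ∫ x in KZ.cube 0, s.integrand x = 0) : RealStokesForm 0 s := by
  refine ⟨0, 0, Fin.elim0, Fin.elim0, fun j => j.elim0, fun z _ => ?_⟩
  rw [setIntegral_cube_zero s.integrand (fun a => z (Fin.castAdd 0 a))] at hint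
  rw [hint]
  simp

/-! ## §3 The `⊇` half of the leaf (soundness of S6) -/

/-- Every Stokes element of an admissible `G` integrates to `0` (tree theorem
`AyoubRel.intC_relAC_eq_zero`), hence so does every element of their `ℚ`-span: the leaf S6 asserts the
converse inclusion. [Ayoub 2015, Conj. 1.1 (`⊇`)] -/
theorem S6_supset (F : CSeries)
    (hF : F ∈ kSpan (Rat.castHom ℂ) {x : CSeries | ∃ G ∈ Oan (Rat.castHom ℂ), ∃ i : ℕ, x = relAC i G}) :
    intC F = 0 := by
  classical
  obtain ⟨n, c, v, hv, rfl⟩ := hF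
  -- each Stokes element integrates to zero, as a `HasSum` statement for the integrand of `intC`
  have hterm : ∀ j, HasSum (fun a : ℕ →₀ ℕ =>
      MvPowerSeries.coeff a (v j) * ∏ l ∈ a.support, ((a l : ℂ) + 1)⁻¹) 0 := by
    intro j
    obtain ⟨G, hG, i, hx⟩ := hv j
    rw [hx]
    exact AyoubRel.hasSum_intC_relAC (AyoubRel.summable_norm_coeff_of_mem_Oan (Rat.castHom ℂ) hG) i
  have hsum : HasSum (fun a : ℕ →₀ ℕ =>
      MvPowerSeries.coeff a (∑ j, ((Rat.castHom ℂ) (c j)) • v j) * ∏ l ∈ a.support, ((a l : ℂ) + 1)⁻¹)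
      (∑ j : Fin n, ((Rat.castHom ℂ) (c j)) * 0) := by
    have h := hasSum_sum (s := (Finset.univ : Finset (Fin n)))
      (f := fun j (a : ℕ →₀ ℕ) => ((Rat.castHom ℂ) (c j)) *
        (MvPowerSeries.coeff a (v j) * ∏ l ∈ a.support, ((a l : ℂ) + 1)⁻¹))
      (fun j _ => (hterm j).mul_left ((Rat.castHom ℂ) (c j)))
    convert h using 1
    funext a
    rw [map_sum, Finset.sum_mul]
    refine Finset.sum_congr rfl fun j _ => ?_
    rw [MvPowerSeries.coeff_smul]
    ring
  rw [intC, hsum.tsum_eq]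
  simp

/-! ## §A Appendix — the superseded gen-2 registry (`cf2fa037…`, planner g2, 2026-08-16T04:21:50Z)

Its T3 `stub_evalEqIntC : ∀ M s F, s.domain = unitCube M → F ∈ Oan ℚ → DependsOnlyOnLT F M →
Realises M F s.integrand → ((eval (of s) : ℝ) : ℂ) = intC F` carried NO realness hypothesis on `F`; with the
private `Realises` read as "the REAL PARTS of the coefficients sum to the integrand" it is false. Recorded so the
signature is not resurrected without `IsReal F →` (free in that composition: T2 supplied it). -/

/-- Extend a point of the `M`-cube to all variables by `0`. -/
def ext (M : ℕ) (x : Fin M → ℝ) : ℕ → ℝ := fun i => if h : i < M then x ⟨i, h⟩ else 0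

/-- Reading R of the gen-2 private `Realises`: the real parts of the coefficients of `F` sum to `f` on the
closed cube. -/
def RealisesR (M : ℕ) (F : CSeries) (f : (Fin M → ℝ) → ℝ) : Prop :=
  ∀ x ∈ unitCube M, HasSum (fun a : ℕ →₀ ℕ =>
    (MvPowerSeries.coeff a F).re * ∏ i ∈ a.support, (ext M x i) ^ (a i)) (f x)

/-- gen-2 T3 `stub_evalEqIntC` under reading R. -/
def Gen2StubEvalEqIntC_R : Prop := ∀ (M : ℕ) (s : IntegralRep M) (F : CSeries), s.domain = unitCube M →
  F ∈ Oan (Rat.castHom ℂ) → DependsOnlyOnLT F M → RealisesR M F s.integrand → ((eval (of s) : ℝ) : ℂ) = intC F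

/-- The constant series `i`. -/
def constI : CSeries := MvPowerSeries.C Complex.I

theorem coeff_constI (a : ℕ →₀ ℕ) : MvPowerSeries.coeff a constI = if a = 0 then Complex.I else 0 := by
  classical
  unfold constI
  rw [MvPowerSeries.coeff_C]

/-- `i ∈ 𝒪_{ℚ-alg}(𝔻̄^∞)`: depends on no variable, entire, root of `Y² + 1 ∈ ℚ[z][Y]`. [folklore] -/
theorem constI_mem_Oan : constI ∈ Oan (Rat.castHom ℂ) := by
  classical
  refine ⟨⟨0, fun a ⟨i, _, hi⟩ => ?_⟩, ⟨2, one_lt_two, ?_⟩, ⟨Polynomial.X ^ 2 + Polynomial.C 1, ?_, ?_⟩⟩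
  · rw [coeff_constI, if_neg]
    rintro rfl
    exact hi rfl
  · refine summable_of_ne_finset_zero (s := {0}) fun a ha => ?_
    rw [Finset.mem_singleton] at ha
    simp [coeff_constI, ha]
  · intro h
    have := congrArg (fun p => Polynomial.coeff p 0) h
    simp at this
  · have h1 : Polynomial.eval₂ (AyoubRel.polyToCSeries (Rat.castHom ℂ)) constI
        (Polynomial.X ^ 2 + Polynomial.C 1) = constI ^ 2 + 1 := by
      simp [Polynomial.eval₂_add]
    rw [h1]
    unfold constI
    rw [← map_pow, Complex.I_sq, map_neg, map_one, neg_add_cancel]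

/-- `∫ i = i`. [folklore] -/
theorem intC_constI : intC constI = Complex.I := by
  classical
  rw [intC, tsum_eq_single 0]
  · simp [coeff_constI]
  · intro b hb
    simp [coeff_constI, hb]

theorem dependsOnlyOnLT_constI : DependsOnlyOnLT constI 0 := by
  classical
  intro a ⟨i, _, hi⟩
  rw [coeff_constI, if_neg]
  rintro rfl
  exact hi rfl

/-- Under reading R the zero function realises `i` (all real parts vanish). -/
theorem realisesR_constI_zero : RealisesR 0 constI (fun _ => 0) := by
  classical
  intro x _
  have : (fun a : ℕ →₀ ℕ => (MvPowerSeries.coeff a constI).re * ∏ i ∈ a.support, (ext 0 x i) ^ (a i)) = 0 := by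
    funext a
    rw [coeff_constI]
    split_ifs <;> simp
  rw [this]
  exact hasSum_zero

/-- **gen-2 T3 is false under reading R**: witness `M = 0`, `F = i`, `s = [pt, 0]`
(`eval [s] = 0 ≠ i = intC F`). [folklore] -/
theorem gen2_stub_evalEqIntC_false_of_readingR : ¬ Gen2StubEvalEqIntC_R := by
  intro h
  obtain ⟨z, hzd, hzi⟩ := KZ.exists_zeroRep (σ := unitCube 0) KZ.isSemialgebraic_cube
  have hreal : RealisesR 0 constI z.integrand := by
    rw [hzi]; exact realisesR_constI_zero
  have := h 0 z constI hzd constI_mem_Oan dependsOnlyOnLT_constI hreal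
  rw [intC_constI] at this
  have hval : eval (of z) = 0 :=
    relations_le_ker_eval_holds (KZ.of_mem_relations_of_eqOn_zero z (by rw [hzi]; intro x _; rfl))
  rw [hval] at this
  simpa using congrArg Complex.im this

end Summit.KontsevichZagierPeriods.KontsevichZagierPeriods.Cruxes.SectorToKernel.DrefuteECS
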